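import Summits.QuantumFields.YangMills.Theorems.BalabanUVNodesN15KingModelHeatKernelFullPropagatorPowerLaw
import Summits.QuantumFields.YangMills.Theorems.BalabanUVNodesN15KingModelCovariantBlockFieldDomination
import HarnessLib

/-!
# BalabanUVNodes ∕ N15 — THE KING-MODEL RUNG (PART Ϻ-e): ★★★★ THE η-UNIFORM INVERSE-SQUARE LAW FOR NE2's UNIT LAYER — King's block-field covariance `C = (Δ^{(K)})⁻¹` on the block torus `(ℤ∕M₀)⁴`:
# `0 ≤ (C − a⁻¹1)(y,y′) ≤ 8(34016 + 10∕m²)∕(1 + dist_M(y,y′)²)` for EVERY block size `L ≥ 1`, EVERY volume `M₀ ≥ 1`; and AT EVERY UNITARY LINK FIELD `U`, every tree contour system: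
# `‖((Δ_eff(U))⁻¹)_{yy′} − a⁻¹δ_{yy′}·1‖ ≤ 8(34016 + 10∕m²)∕(1 + dist_M(y,y′)²)` (Ϥ-l's domination BY NAME)
# (Track A, DAG node N15 = NE2; FAN-OUT v1.1 §N15 s3 «KING-MODEL RUNG … + what the curved case adds»; count-neutral)

HONEST FRAMING.  Count-neutral (cell `pub-ymgap`, seat `pub-ymgap-dag-n15-e` g56; `--supports stmt-QuantumFields-27247 --as helper` = K3ᴬ, KEY MAP v3).  NE2's UNIT LAYER in King's one-level comparison model:
the covariance of the block field after one renormalization step, `C = (Δ_eff)⁻¹ = a⁻¹1 + L^{d+1}QGQᵀ` ([King1986] (2.14) p.653, (4.44)–(4.45) p.675; the g0 rung's `effLaplacian_inv_eq_noise_add_blockAvg`, Ϥ-l's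
entry form `king_blockCov_sub_noise_apply`: `(C − a⁻¹1)(y,y′) = L^{−(d+1)}Σ_{j,j′}G(x_j,x′_{j′})` over the sites of the two blocks).  What the tree held for its decay: King's (4.34)-type EXPONENTIAL decay
`|C(b,b′)| ≤ (2∕γ_m)e^{−κ_m·dist}` for the TOWER parameters `a_k = aK a L₀ k`, `L = L₀^k` (`King1986.Torus.effLaplacian_inv_decay`, Ϥ-l `norm_blk_effLapU_inv_le_king_decay`), and the operator sandwich
`a⁻¹ ≤ C ≤ a⁻¹ + m⁻²` (Ϥ-k).  THIS FILE adds the η-UNIFORM POWER LAW at EVERY `(a, L)` (no tower hypothesis), explicit absolute constants, by PART Ϣ-j's fine-lattice law on the `L⁴ × L⁴` site pairs of two blocks: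
* §1 (every dimension) ★ `king_blockCov_sub_noise_nonneg` (`(C − a⁻¹1)(y,y′) ≥ 0`, `G ≥ 0`), ★★ `king_blockCov_sub_noise_le_inv_mass` (`≤ 1∕m²`: each inner block sum `Σ_{j′}G(x_j,x′_{j′}) ≤ Σ_xG(x_j,x) = 1∕m²`, Ϻ-a);
* §2 (`d+1 = 4`) ★ `one_div_le_blocks_far` (`D ≥ 2`, `s ≥ LD − (L−1)` ⟹ `1∕(1+s²) ≤ 8∕(L²(1+D²))`), ★★ `king_blockCov_sub_noise_le_far` (`D = dist_M(y,y′) ≥ 2`: `(C − a⁻¹1)(y,y′) ≤ 8C₀∕(1+D²)`, `C₀ = 34016+10∕m²`),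
  ★★★★ **`king_blockCov_powerLaw_eta_uniform`** (ALL `y, y′`, every `L`, every `M₀`: `0 ≤ (C − a⁻¹1)(y,y′) ≤ 8C₀∕(1 + dist_M(y,y′)²)` — near zone by §1 since `1∕m² ≤ 8C₀∕5`), ★★★ `king_blockCov_entry_le`
  (`|C(y,y′)| ≤ a⁻¹δ_{yy′} + 8C₀∕(1+dist²)`: block-spin noise on the diagonal plus the inverse-square cluster term);
* §3 ★★★★ **`norm_blk_effLapU_inv_sub_noise_le_powerLaw`** — AT EVERY UNITARY `U` (any `RCLike` fibre, any tree contour system `T`): `‖((Δ_eff(U))⁻¹)_{yy′} − a⁻¹δ·1‖ ≤ 8C₀∕(1+dist_M(y,y′)²)` (Ϥ-l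
  `norm_blk_effLapU_inv_sub_noise_le_king` BY NAME — NE2's unit layer at curved fields costs nothing); ★★★ `king_blockCov_powerLaw_what_the_curved_case_adds` (package).
HONEST SCOPE: King's `A = 0` one-level comparison model, King's scaling `c = L²`; cubic tori `(ℤ∕LM₀)⁴ → (ℤ∕M₀)⁴`, `d+1 = 4` only; BLOCK units (the unit lattice of the block field); crude absolute constants; mass through
`10∕m²`; the exponential tail beyond the correlation length is NOT captured (power law only; the tree's `effLaplacian_inv_decay` has it for towers); NOT Bałaban's multi-level `C^{(k)}(U)` ∕ (3.42); NOT a node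
discharge (N15 of record untouched); nothing continuum ∕ ℝ⁴ ∕ OS ∕ mass gap ∕ Clay.
PRIOR TREE ART (by name): Ϥ-l (`king_blockCov_sub_noise_apply`, `norm_blk_effLapU_inv_sub_noise_le_king`), Ϥ-k (`effLapU`), Ϻ-a (`blockSum_lapF_inv_le_inv_mass`, `blockSum`), Ϻ-c (`card_offsets_four`), Ϣ-j
(`king_green_powerLaw_tdistT`), R-a-type geometry (King1986.Torus `mul_tdistT_blocks_le`, `site`, `tdistT_nonneg`), Ͱ-b (`lapF_inv_entry_nonneg`), `LatticeDiamagneticInequality.blk`, `Beta.WoodburyFibre.cM`.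
Dedup (rg at filing): basename 0 files; needles `king_blockCov_sub_noise_nonneg|king_blockCov_sub_noise_le_inv_mass|king_blockCov_powerLaw_eta_uniform|norm_blk_effLapU_inv_sub_noise_le_powerLaw|king_blockCov_entry_le` 0 tree files.
presearch: as Ϻ-d (no in-tree or held statement of the one-level unit-layer law uniform in `L`; composition of in-tree theorems, no new Literature fact).
Locators: [King1986] C. King, CMP 102 (1986) 649–677: (2.13)–(2.14) p.653, (4.5) p.670, (4.33)–(4.34) p.674, (4.44)–(4.45) p.675; [Balaban1984PropagatorsI] (1.29) p.23; [Balaban1985BackgroundPropagators] (3.19) p.393,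
(3.25) p.394; [Dimock2013] App. D Lemmas 29–30; [DodziukMathai2006] Thm 1.5 §1 (Kato domination, as landed in Ͱ-b).  0 `sorry`, 0 `def`.
-/

noncomputable section

open Real Finset Matrix
open scoped BigOperators Matrix.Norms.L2Operator

namespace Summit.QuantumFields.YangMills.BalabanUVNodes.N15KingModelRung.HeatKernel

open Literature.MathematicalPhysics.QuantumFieldTheory.LatticeDiamagneticInequality (blk)
open Literature.MathematicalPhysics.QuantumFieldTheory.Balaban1983to89.B5Prop11Plancherel (Tor fine)
open Literature.MathematicalPhysics.QuantumFieldTheory.Balaban1983to89.Beta.WoodburyFibre (cM)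
open Literature.MathematicalPhysics.QuantumFieldTheory.King1986.Torus (lapF effLaplacian blockSum site blockOf mul_tdistT_blocks_le tdistT tdistT_nonneg)
open Summit.QuantumFields.YangMills.BalabanUVNodes.N15KingModelRung.Covariant (lapF_inv_entry_nonneg)
open Summit.QuantumFields.YangMills.BalabanUVNodes.N15KingModelRung.CovariantBlock (BlockTree effLapU king_blockCov_sub_noise_apply norm_blk_effLapU_inv_sub_noise_le_king)

/-! ## §1 Every dimension: non-negativity and the `1∕m²` ceiling -/

section AnyDim

variable {d : ℕ} (L : ℕ) [NeZero L] (M : Fin (d + 1) → ℕ) [hM : ∀ μ, NeZero (M μ)] {a m2 : ℝ}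

/-- ★ `(C − a⁻¹1)(y,y′) = L^{−(d+1)}Σ_{j,j′}G(x_j,x′_{j′}) ≥ 0` (`G ≥ 0` entrywise). [cite: King1986, (2.14) p.653, (4.45) p.675] -/
theorem king_blockCov_sub_noise_nonneg (ha : 0 < a) (hm : 0 < m2) (y y' : Tor M) :
    0 ≤ ((effLaplacian L M a ((L : ℝ) ^ 2) m2)⁻¹ - a⁻¹ • (1 : Matrix (Tor M) (Tor M) ℝ)) y y' := by
  have hL : 1 ≤ L := Nat.one_le_iff_ne_zero.mpr (NeZero.ne L)
  rw [king_blockCov_sub_noise_apply M hL ha hm y y']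
  exact mul_nonneg (by positivity) (Finset.sum_nonneg fun _ _ => Finset.sum_nonneg fun _ _ => lapF_inv_entry_nonneg (fine L M) (by positivity) hm _ _)

/-- ★★ THE `1∕m²` CEILING: `(C − a⁻¹1)(y,y′) ≤ 1∕m²` for ALL `y, y′`, every `L`, every torus (each inner block sum `Σ_{j′}G(x_j,x′_{j′}) ≤ Σ_xG(x_j,x) = 1∕m²`, Ϻ-a, over the `L^{d+1}` sites `x_j`).
[cite: King1986, (2.14) p.653, (4.45) p.675, (2.16) p.653] -/
theorem king_blockCov_sub_noise_le_inv_mass (ha : 0 < a) (hm : 0 < m2) (y y' : Tor M) :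
    ((effLaplacian L M a ((L : ℝ) ^ 2) m2)⁻¹ - a⁻¹ • (1 : Matrix (Tor M) (Tor M) ℝ)) y y' ≤ m2⁻¹ := by
  have hL : 1 ≤ L := Nat.one_le_iff_ne_zero.mpr (NeZero.ne L)
  have hLd : 0 < ((L : ℝ) ^ (d + 1)) := pow_pos (by exact_mod_cast Nat.pos_of_ne_zero (NeZero.ne L)) _
  rw [king_blockCov_sub_noise_apply M hL ha hm y y']
  have hinner : ∀ j : Fin (d + 1) → Fin L, ∑ j' : Fin (d + 1) → Fin L, (lapF (fine L M) ((L : ℝ) ^ 2) m2)⁻¹ (site L M y j) (site L M y' j') ≤ m2⁻¹ :=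
    fun j => blockSum_lapF_inv_le_inv_mass L M (by positivity) hm (site L M y j) y'
  have hcard : (Fintype.card (Fin (d + 1) → Fin L) : ℝ) = (L : ℝ) ^ (d + 1) := by
    rw [Fintype.card_fun, Fintype.card_fin, Fintype.card_fin]; push_cast; ring
  calc ((L : ℝ) ^ (d + 1))⁻¹ * ∑ j : Fin (d + 1) → Fin L, ∑ j' : Fin (d + 1) → Fin L, (lapF (fine L M) ((L : ℝ) ^ 2) m2)⁻¹ (site L M y j) (site L M y' j')
      ≤ ((L : ℝ) ^ (d + 1))⁻¹ * ∑ _j : Fin (d + 1) → Fin L, m2⁻¹ := mul_le_mul_of_nonneg_left (Finset.sum_le_sum fun j _ => hinner j) (inv_pos.mpr hLd).le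
    _ = m2⁻¹ := by rw [Finset.sum_const, Finset.card_univ, nsmul_eq_mul, hcard]; field_simp

end AnyDim

/-! ## §2 Four dimensions: the inverse-square law in block units -/

section Four

variable (L M₀ : ℕ) [NeZero L] [NeZero M₀] {a m2 : ℝ}

omit [NeZero L] [NeZero M₀] in
/-- ★ FAR BLOCKS: if `D ≥ 2`, `s ≥ L·D − (L−1)` and `L ≥ 1` then `1∕(1+s²) ≤ 8∕(L²(1+D²))` (`s ≥ LD∕2`, `D² ≥ (1+D²)∕2`). [folklore] -/
theorem one_div_le_blocks_far {Lr D s : ℝ} (hL : 1 ≤ Lr) (hD : 2 ≤ D) (hs : Lr * D - (Lr - 1) ≤ s) : 1 / (1 + s ^ 2) ≤ 8 / (Lr ^ 2 * (1 + D ^ 2)) := by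
  have h1 : Lr * D / 2 ≤ s := by nlinarith
  have h0 : 0 ≤ Lr * D / 2 := by positivity
  have h2 : (Lr * D / 2) ^ 2 ≤ s ^ 2 := pow_le_pow_left₀ h0 h1 2
  have hD2 : 4 ≤ D ^ 2 := by nlinarith
  have hL2 : 0 ≤ Lr ^ 2 := sq_nonneg _
  have h3 : Lr ^ 2 * (1 + D ^ 2) ≤ 2 * (Lr * D) ^ 2 := by nlinarith [mul_le_mul_of_nonneg_left hD2 hL2]
  rw [div_le_div_iff₀ (by positivity) (by positivity)]
  nlinarith

/-- ★★ THE FAR ZONE IN BLOCK UNITS: for `dist_M(y,y′) ≥ 2`, `(C − a⁻¹1)(y,y′) ≤ 8(34016+10∕m²)∕(1 + dist_M(y,y′)²)` (PART Ϣ-j on each of the `L⁴·L⁴` site pairs, all at fine distance `≥ L(D−1)+1`).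
[cite: King1986, (2.13)–(2.14) p.653, (4.4) p.670, (4.45) p.675] -/
theorem king_blockCov_sub_noise_le_far (ha : 0 < a) (hm : 0 < m2) (y y' : Tor (cM M₀)) (hD : 2 ≤ tdistT (cM M₀) y y') :
    ((effLaplacian L (cM M₀) a ((L : ℝ) ^ 2) m2)⁻¹ - a⁻¹ • (1 : Matrix (Tor (cM M₀)) (Tor (cM M₀)) ℝ)) y y' ≤ 8 * (34016 + 10 / m2) / (1 + tdistT (cM M₀) y y' ^ 2) := by
  have hL : 1 ≤ L := Nat.one_le_iff_ne_zero.mpr (NeZero.ne L)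
  have hL1 : (1 : ℝ) ≤ L := by exact_mod_cast hL
  have hL2 : (0 : ℝ) < (L : ℝ) ^ 2 := by positivity
  have hL4 : (0 : ℝ) < (L : ℝ) ^ 4 := by positivity
  have hC0 : 0 ≤ (34016 + 10 / m2 : ℝ) := by positivity
  rw [king_blockCov_sub_noise_apply (cM M₀) hL ha hm y y']
  have hterm : ∀ j j' : Fin 4 → Fin L, (lapF (fine L (cM M₀)) ((L : ℝ) ^ 2) m2)⁻¹ (site L (cM M₀) y j) (site L (cM M₀) y' j')
      ≤ 8 * (34016 + 10 / m2) / ((L : ℝ) ^ 4 * (1 + tdistT (cM M₀) y y' ^ 2)) := by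
    intro j j'
    have hs := mul_tdistT_blocks_le L (cM M₀) y y' j j'
    have hpl := king_green_powerLaw_tdistT L M₀ hm (site L (cM M₀) y j) (site L (cM M₀) y' j')
    have hfar := one_div_le_blocks_far (s := tdistT (fine L (cM M₀)) (site L (cM M₀) y j) (site L (cM M₀) y' j')) hL1 hD (by linarith)
    calc (lapF (fine L (cM M₀)) ((L : ℝ) ^ 2) m2)⁻¹ (site L (cM M₀) y j) (site L (cM M₀) y' j')
        ≤ |(lapF (fine L (cM M₀)) ((L : ℝ) ^ 2) m2)⁻¹ (site L (cM M₀) y j) (site L (cM M₀) y' j')| := le_abs_self _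
      _ ≤ ((34016 + 10 / m2) / (1 + tdistT (fine L (cM M₀)) (site L (cM M₀) y j) (site L (cM M₀) y' j') ^ 2)) / (L : ℝ) ^ 2 := by
          rw [le_div_iff₀ hL2, mul_comm]; exact hpl
      _ = ((34016 + 10 / m2) / (L : ℝ) ^ 2) * (1 / (1 + tdistT (fine L (cM M₀)) (site L (cM M₀) y j) (site L (cM M₀) y' j') ^ 2)) := by ring
      _ ≤ ((34016 + 10 / m2) / (L : ℝ) ^ 2) * (8 / ((L : ℝ) ^ 2 * (1 + tdistT (cM M₀) y y' ^ 2))) := mul_le_mul_of_nonneg_left hfar (by positivity)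
      _ = 8 * (34016 + 10 / m2) / ((L : ℝ) ^ 4 * (1 + tdistT (cM M₀) y y' ^ 2)) := by field_simp
  have hL31 : ((L : ℝ) ^ (3 + 1)) = (L : ℝ) ^ 4 := by norm_num
  calc ((L : ℝ) ^ (3 + 1))⁻¹ * ∑ j : Fin 4 → Fin L, ∑ j' : Fin 4 → Fin L, (lapF (fine L (cM M₀)) ((L : ℝ) ^ 2) m2)⁻¹ (site L (cM M₀) y j) (site L (cM M₀) y' j')
      ≤ ((L : ℝ) ^ (3 + 1))⁻¹ * ∑ _j : Fin 4 → Fin L, ∑ _j' : Fin 4 → Fin L, 8 * (34016 + 10 / m2) / ((L : ℝ) ^ 4 * (1 + tdistT (cM M₀) y y' ^ 2)) := by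
        rw [hL31]
        exact mul_le_mul_of_nonneg_left (Finset.sum_le_sum fun j _ => Finset.sum_le_sum fun j' _ => hterm j j') (inv_pos.mpr hL4).le
    _ = 8 * (34016 + 10 / m2) / (1 + tdistT (cM M₀) y y' ^ 2) := by
        rw [hL31, Finset.sum_const, Finset.card_univ, nsmul_eq_mul, Finset.sum_const, Finset.card_univ, nsmul_eq_mul, card_offsets_four]
        field_simp

/-- ★★★★ **THE η-UNIFORM INVERSE-SQUARE LAW FOR NE2's UNIT LAYER** (King's block-field covariance `C = (Δ^{(K)})⁻¹` on the block torus `(ℤ∕M₀)⁴`): for ALL `y, y′`, EVERY block size `L ≥ 1`, EVERY volume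
`M₀ ≥ 1` (`a, m² > 0`), `0 ≤ (C − a⁻¹1)(y,y′) ≤ 8(34016+10∕m²)∕(1 + dist_M(y,y′)²)` — the cluster property of the block field in BLOCK units, uniform in the spacing `η = 1∕L` of the fine field it came from.
[cite: King1986, (2.13)–(2.14) p.653, (4.34) p.674, (4.44)–(4.45) p.675; Balaban1984PropagatorsI, (1.29) p.23] -/
theorem king_blockCov_powerLaw_eta_uniform (ha : 0 < a) (hm : 0 < m2) (y y' : Tor (cM M₀)) :
    0 ≤ ((effLaplacian L (cM M₀) a ((L : ℝ) ^ 2) m2)⁻¹ - a⁻¹ • (1 : Matrix (Tor (cM M₀)) (Tor (cM M₀)) ℝ)) y y'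
      ∧ ((effLaplacian L (cM M₀) a ((L : ℝ) ^ 2) m2)⁻¹ - a⁻¹ • (1 : Matrix (Tor (cM M₀)) (Tor (cM M₀)) ℝ)) y y' ≤ 8 * (34016 + 10 / m2) / (1 + tdistT (cM M₀) y y' ^ 2) := by
  refine ⟨king_blockCov_sub_noise_nonneg L (cM M₀) ha hm y y', ?_⟩
  rcases le_or_gt 2 (tdistT (cM M₀) y y') with hD | hD
  · exact king_blockCov_sub_noise_le_far L M₀ ha hm y y' hD
  · -- near zone: `1∕m² ≤ 8C₀∕(1+D²)` since `1 + D² < 5` and `8C₀ ≥ 80∕m²`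
    refine (king_blockCov_sub_noise_le_inv_mass L (cM M₀) ha hm y y').trans ?_
    have hD0 := tdistT_nonneg (cM M₀) y y'
    have h5 : 1 + tdistT (cM M₀) y y' ^ 2 < 5 := by nlinarith
    rw [le_div_iff₀ (by positivity)]
    have hm' : m2⁻¹ * (1 + tdistT (cM M₀) y y' ^ 2) ≤ m2⁻¹ * 5 := mul_le_mul_of_nonneg_left h5.le (inv_pos.mpr hm).le
    have h80 : m2⁻¹ * 5 ≤ 8 * (34016 + 10 / m2) := by rw [div_eq_mul_inv]; nlinarith [inv_pos.mpr hm]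
    linarith

/-- ★★★ **THE ENTRIES OF THE BLOCK-FIELD COVARIANCE**: `|C(y,y′)| ≤ a⁻¹δ_{yy′} + 8(34016+10∕m²)∕(1 + dist_M(y,y′)²)` — block-spin noise on the diagonal plus the η-uniform inverse-square cluster term.
[cite: King1986, (2.14) p.653, (4.45) p.675] -/
theorem king_blockCov_entry_le (ha : 0 < a) (hm : 0 < m2) (y y' : Tor (cM M₀)) :
    |(effLaplacian L (cM M₀) a ((L : ℝ) ^ 2) m2)⁻¹ y y'| ≤ a⁻¹ * (if y = y' then 1 else 0) + 8 * (34016 + 10 / m2) / (1 + tdistT (cM M₀) y y' ^ 2) := by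
  obtain ⟨h0, h1⟩ := king_blockCov_powerLaw_eta_uniform L M₀ ha hm y y'
  rw [Matrix.sub_apply, Matrix.smul_apply, Matrix.one_apply, smul_eq_mul] at h0 h1
  have hnoise : 0 ≤ a⁻¹ * (if y = y' then (1 : ℝ) else 0) := mul_nonneg (inv_pos.mpr ha).le (by split_ifs <;> norm_num)
  rw [abs_le]
  constructor <;> linarith

end Four

/-! ## §3 At every unitary link field -/

section Curved

variable {L : ℕ} [NeZero L] (T : BlockTree 3 L) (M₀ : ℕ) [NeZero M₀]
variable {𝕜 : Type*} [RCLike 𝕜] {n : Type*} [Fintype n] [DecidableEq n] {a m2 : ℝ}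

/-- ★★★★ **NE2's UNIT LAYER AT EVERY UNITARY LINK FIELD OBEYS THE SAME η-UNIFORM INVERSE-SQUARE LAW**: for every tree contour system `T`, every unitary `U` on the fine four-torus, all blocks `y, y′`,
every `L ≥ 1`, every `M₀ ≥ 1`: `‖((Δ_eff(U))⁻¹)_{yy′} − a⁻¹δ_{yy′}·1‖ ≤ 8(34016+10∕m²)∕(1 + dist_M(y,y′)²)` (Ϥ-l's blockwise domination by King's `A = 0` object, BY NAME).
[cite: King1986, (2.14) p.653, (4.34) p.674, (4.45) p.675; Balaban1985BackgroundPropagators, (3.19) p.393, (3.25) p.394; DodziukMathai2006, Thm 1.5 §1] -/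
theorem norm_blk_effLapU_inv_sub_noise_le_powerLaw (ha : 0 < a) (hm : 0 < m2) {U : Tor (fine L (cM M₀)) × Fin 4 → Matrix n n 𝕜} (hU : ∀ bd, U bd ∈ Matrix.unitaryGroup n 𝕜)
    (y y' : Tor (cM M₀)) :
    ‖blk ((effLapU T (cM M₀) a ((L : ℝ) ^ 2) m2 U)⁻¹) y y' - (if y = y' then (a⁻¹ : 𝕜) else 0) • (1 : Matrix n n 𝕜)‖ ≤ 8 * (34016 + 10 / m2) / (1 + tdistT (cM M₀) y y' ^ 2) :=
  (norm_blk_effLapU_inv_sub_noise_le_king T (cM M₀) (Nat.one_le_iff_ne_zero.mpr (NeZero.ne L)) ha hm hU y y').trans (king_blockCov_powerLaw_eta_uniform L M₀ ha hm y y').2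

/-- ★★★ **WHAT THE CURVED CASE ADDS FOR NE2's UNIT LAYER — NOTHING** (package): the flat law (both signs) and the same law at every unitary `U`, every tree contour system, same constant.
[cite: King1986, (2.14) p.653, (4.45) p.675; Balaban1985BackgroundPropagators, (3.19) p.393] -/
theorem king_blockCov_powerLaw_what_the_curved_case_adds (ha : 0 < a) (hm : 0 < m2) {U : Tor (fine L (cM M₀)) × Fin 4 → Matrix n n 𝕜} (hU : ∀ bd, U bd ∈ Matrix.unitaryGroup n 𝕜) :
    (∀ y y' : Tor (cM M₀), 0 ≤ ((effLaplacian L (cM M₀) a ((L : ℝ) ^ 2) m2)⁻¹ - a⁻¹ • (1 : Matrix (Tor (cM M₀)) (Tor (cM M₀)) ℝ)) y y'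
        ∧ ((effLaplacian L (cM M₀) a ((L : ℝ) ^ 2) m2)⁻¹ - a⁻¹ • (1 : Matrix (Tor (cM M₀)) (Tor (cM M₀)) ℝ)) y y' ≤ 8 * (34016 + 10 / m2) / (1 + tdistT (cM M₀) y y' ^ 2))
      ∧ (∀ y y' : Tor (cM M₀), ‖blk ((effLapU T (cM M₀) a ((L : ℝ) ^ 2) m2 U)⁻¹) y y' - (if y = y' then (a⁻¹ : 𝕜) else 0) • (1 : Matrix n n 𝕜)‖
          ≤ 8 * (34016 + 10 / m2) / (1 + tdistT (cM M₀) y y' ^ 2)) :=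
  ⟨fun y y' => king_blockCov_powerLaw_eta_uniform L M₀ ha hm y y', fun y y' => norm_blk_effLapU_inv_sub_noise_le_powerLaw T M₀ ha hm hU y y'⟩

end Curved

end Summit.QuantumFields.YangMills.BalabanUVNodes.N15KingModelRung.HeatKernel

end
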